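import Mathlib
import Summits.Ventures.HodgeRepro.Tier4.Common.AdelicRTF

/-!
# Tier4/Common/AdelicKernel — the defined kernel `K_f` is invariant under the rational points on both sides, and
the right regular action preserves left-invariance (the first two bookkeeping facts of L1.1 / L1.2 on the defined
objects)

Blind re-derivation cell `pub-hodge-repro`, Tier 4 (README §9–§10), seat t4-typer-2 (gen 0).  Target tree path
`lean/Summits/Ventures/HodgeRepro/Tier4/Common/AdelicKernel.lean`.  Imports `Tier4/Common/AdelicRTF.lean`
(`kernel W f x y := ∑' γ : rationalPoints W, f (x⁻¹ * γ * y)`, `rightRegular`).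

WHAT IS PROVED (Mathlib only; `tsum` reindexing along the bijections `δ ↦ γ⁻¹ δ`, `δ ↦ δ γ` of `G(k)`):
* `kernel_mul_left : K_f (γ x, y) = K_f (x, y)` and `kernel_mul_left' : K_f (x, γ y) = K_f (x, y)` for
  `γ ∈ G(k)` — the kernel is a function on `[G] × [G]` = `G(k)\G(𝔸) × G(k)\G(𝔸)` (LEFT invariance in both
  variables; `KernelLeftInvariant` of the v0.3 interface holds for the defined kernel,
  `kernelLeftInvariant_ofDefs`; the interface's `KernelRightInvariant` — invariance under `y ↦ y γ` — is NOT a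
  property of this kernel and is not claimed);
* `kernel_symm_inv : K_f (x, y) = K_{f̌} (y, x)` with `f̌ g := f g⁻¹` (the kernel of the dual test function);
* `rightRegular_mul_left`: if `φ` is left-`G(k)`-invariant so is `R(f) φ` (for every `f`, every measure).
Nothing here says anything about the status of the Hodge conjecture for CM abelian varieties, which is NOT proved
(HC_CM is NOT proved by anyone in this repository).
-/

set_option autoImplicit false

noncomputable section

namespace Summit.Ventures.HodgeRepro.Tier4.Common

open MeasureTheory

variable {k : Type} [Field k] [NumberField k] {W : PlaneData k}

/-- Left multiplication by a rational point, as a bijection of the rational points. -/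
def rationalMulLeft (γ : rationalPoints W) : rationalPoints W ≃ rationalPoints W :=
  Equiv.mulLeft γ

/-- Right multiplication by a rational point, as a bijection of the rational points. -/
def rationalMulRight (γ : rationalPoints W) : rationalPoints W ≃ rationalPoints W :=
  Equiv.mulRight γ

/-- **Left invariance of the kernel**: `K_f (γ x, y) = K_f (x, y)` for `γ ∈ G(k)`. -/
theorem kernel_mul_left (f : GA W → ℂ) (γ : rationalPoints W) (x y : GA W) :
    kernel W f ((γ : GA W) * x) y = kernel W f x y := by
  unfold kernel
  rw [← (rationalMulLeft γ).tsum_eq]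
  refine tsum_congr fun δ => ?_
  simp only [rationalMulLeft, Equiv.coe_mulLeft, Subgroup.coe_mul]
  congr 1
  group

/-- **Left invariance of the kernel in the second variable**: `K_f (x, γ y) = K_f (x, y)` for `γ ∈ G(k)`. -/
theorem kernel_mul_left' (f : GA W → ℂ) (γ : rationalPoints W) (x y : GA W) :
    kernel W f x ((γ : GA W) * y) = kernel W f x y := by
  unfold kernel
  rw [← (rationalMulRight γ⁻¹).tsum_eq]
  refine tsum_congr fun δ => ?_
  simp only [rationalMulRight, Equiv.coe_mulRight, Subgroup.coe_mul, Subgroup.coe_inv]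
  congr 1
  group

/-- The v0.3 interface predicate `KernelLeftInvariant` holds for the defined kernel (in the conjugate-convention
instantiation). -/
theorem kernelLeftInvariant_ofDefs [MeasurableSpace (torusT W)] [MeasurableSpace (torusT' W)] (R : RTFData W) :
    R.toAdelicPairConj.KernelLeftInvariant := by
  intro f γ hγ x y
  exact kernel_mul_left f ⟨γ, hγ⟩ x y

/-- The dual test function `f̌ g := f g⁻¹`. -/
def dualFn (f : GA W → ℂ) : GA W → ℂ := fun g => f g⁻¹

/-- Inversion, as a bijection of the rational points. -/
def rationalInv : rationalPoints W ≃ rationalPoints W := Equiv.inv _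

/-- **Symmetry of the kernel**: `K_f (x, y) = K_{f̌} (y, x)`. -/
theorem kernel_symm_inv (f : GA W → ℂ) (x y : GA W) : kernel W f x y = kernel W (dualFn f) y x := by
  unfold kernel dualFn
  rw [← (rationalInv (W := W)).tsum_eq]
  refine tsum_congr fun δ => ?_
  simp only [rationalInv, Equiv.inv_apply, Subgroup.coe_inv]
  congr 1
  group

/-- The right regular action preserves left invariance under a subgroup `K`: if `φ (κ x) = φ x` for `κ ∈ K` then
the same holds for `R(f) φ`. -/
theorem rightRegular_mul_left [MeasurableSpace (GA W)] (μ : Measure (GA W)) (f φ : GA W → ℂ) (K : Subgroup (GA W))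
    (hφ : ∀ x : GA W, ∀ κ ∈ K, φ (κ * x) = φ x) (x : GA W) (κ : GA W) (hκ : κ ∈ K) :
    rightRegular W μ f φ (κ * x) = rightRegular W μ f φ x := by
  unfold rightRegular
  refine integral_congr_ae (Filter.Eventually.of_forall fun y => ?_)
  simp only [mul_assoc, hφ (x * y) κ hκ]

end Summit.Ventures.HodgeRepro.Tier4.Common

end
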